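import Literature.MathematicalPhysics.QuantumFieldTheory.Balaban1983to89.B8Prop5SocketDatum
import Literature.MathematicalPhysics.QuantumFieldTheory.Balaban1983to89.B8Eq142KLevelLocalGamma
import Literature.MathematicalPhysics.QuantumFieldTheory.Balaban1983to89.B8Prop3KLevelGamma

/-!
# `Balaban1983to89.B8Prop5SocketDatumGamma` — [Balaban1985RegularSpaces] THE DATUM OF PROPOSITION 5 AT `k` LEVELS: «(1.69) from (1.67)–(1.68) by
# Proposition 3», EDITION γ — PRINT's BOX LAW «the box of a level-j datum bond lies in Ω_{j−1}» ((1.31) p. 82) for the constraint-bond class read by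
# the (1.59) socket; dag-n05-a's `B8Prop5SocketDatum.grad_bound_of_datum` re-assembled on dag-n05-e's `H42_of_inAx_γ` and on `prop3_norms_kLevel_γ`

statement-level skeleton of published theorems with citation tags; proofs where landed; nothing here is a claim about the Yang–Mills mass gap

T. Bałaban, *Spaces of regular gauge field configurations on a lattice and gauge fixing conditions*, Commun. Math. Phys. **99** (1985) 75–102
`[Balaban1985RegularSpaces]` ("B8"; printed page = PDF page + 74): (1.67)–(1.69) p. 88, Prop. 3 p. 87, (1.40)–(1.42) p. 83, (1.31) + (1.35) p. 82, p. 77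
(«Ω also denotes the set of bonds … at least one end-point of b belongs to Ω»), Prop. 5 p. 94, Thm 4 p. 88; [3] = [Balaban1985Averaging] Prop. 4 p. 38;
[4] = [Balaban1985BackgroundPropagators] Thm 3.3 p. 398.  PDF held: `paper:balaban1985-cmp99-regular-spaces-gauge-fixing`.  STATUS: published, refereed.

CITATION HEADER (lean-in-tree rule).  Cell `pub-ymgap` (YM Track A, DAG node N05 = [B8], HUMAN RULING D-0062 ∕ D-0149 width seats), seat
`pub-ymgap-dag-n05-w4` (g0): W-SEAT-START-LIST v3 §n05 item 4 («the Prop-5 sockets, m ≥ 1 obligation», director-ym №194a OPEN-OBLIGATION note) executed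
as the edition γ of the Prop-5 socket providers.  WHY THIS FILE.  dag-n05-c's kernel certificates `B8Ineq159FlatShellModeVacuity` (p572834) ∕
`B8SockB9P3ShellModeVacuityUniv` (p576185) show that the binder configuration «`hbox` : box ⊂ Ω_j» + «`SB9 : SockB9P3 … Λb`» of the N05 knit is
UNSATISFIABLE at nested members with `k ≥ 1` (the law empties print's crossing bonds of (1.31); interior shell gauge modes kill the socket).  The
Proposition-5 UNIQUENESS provider of record (dag-n04-b `B8SockP5uEAssembly` → dag-n05-d `B8SockP5uEAssemblyB.sockP5uE_body_of_join_b`) reads that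
configuration at EXACTLY ONE place: dag-n05-a's `B8Prop5SocketDatum.grad_bound_of_datum` («(1.69) from (1.67)–(1.68) by Proposition 3 at level
m ≥ 1»), which reads it through the (1.42) LEMMA `B8Eq142KLevelLocal.H42_of_inAx` and n05-b's `B8Prop3KLevel.prop3_norms_kLevel`.  Both now have
editions γ under print's law «box ⊂ Ω_{j−1}» (dag-n05-e `B8Eq142KLevelLocalGamma.H42_of_inAx_γ`; `B8Prop3KLevelGamma.prop3_norms_kLevel_γ` on dag-n05-e's
`B8Thm4KLevelGamma.norm_B1_lt_kLevel_γ`).  THIS FILE is the corresponding edition γ of the datum theorem: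
★ `grad_bound_of_datum_γ` = `grad_bound_of_datum` with the class law `hbox` AND the (1.35) datum hypothesis `h135` guarded by «box ⊂ Ω_{j−1}» (ℕ
subtraction; level 0 reads `Ω₀`; print's p. 77 convention «bonds with at least one end-point in Ω_j» includes the level-`j` crossing bonds), the
[3]-Prop.-4 windows of the (1.42)∕(1.56) steps at `(L²α₀, L·α₂)` and the (1.56) remainder constant `C₂ ≥ 8·131072(d+1)²·e^{4c·L²α₀}·L²`; the (1.55)
windows `16α₂ ≤ 1`, `5α₂(d−1) ≤ 4`, the bootstrap windows «B₀36dα₂ ≦ 1/2», `50dα₂ ≤ 1`, (1.61) and `dLα₁ ≤ 1/8` unchanged; body = the parent's with the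
two calls re-pointed.  Kind «kernel-checked proof», one theorem, no `def`, no `… : Prop` fact, no existing module modified.

HONEST SCOPE ∕ A6.  Re-assembly by name; 0 new estimates.  The b9 socket `SB9 : SockB9P3 … m Ω Λs Λb` is a HYPOTHESIS over a PARAMETRIC class `Λb`
([4] Thm 3.3 in Proposition 3's frame = DAG node N06's content); whether it is satisfiable depends on the class supplied — over a «box ⊂ Ω_j» class at
a nested member it is not (p572834 ∕ p576185); over print's class (dag-n05-c `cubeLamBP` ∕ dag-n06-b `cubeLamBP'` ∕ dag-n05-d `towerBondsP`) it is
print's (1.59), open, inhabited at `m = 0` by dag-n06-b's `B9SupplySockB9P3ZdGamma` witness.  No satisfiability claim is made here.  The datum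
hypotheses (1.33)∕(1.34)∕axial∕(1.35) are Theorem 4's frame (inhabited, e.g. by `U′ = 1`).  Windows displayed, not discharged; `d ≥ 2`, `L ≥ 2`;
`≤`∕`<` as typed; `T_η ↦ ℤᵈ`.  Count-neutral; N05 NOT discharged; no count claim; one finite `𝕋⁴` programme at fixed `ε`, Bałaban as printed; the
Yang–Mills mass gap (Clay) is NOT proved by any of this — R4 closes the conditional finite-`𝕋⁴` rung `BalabanLadder.UV` only; nothing continuum ∕ ℝ⁴ ∕
OS.  No `sorry`, no `def`, no `instance`, no `notation`.  Unit `pub-ymgap-dag-n05-w4` (g0), 2026-08-27.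

RELATED IN THE TREE, NOT DUPLICATED: `B8Prop5SocketDatum` (dag-n05-a; the «box ⊂ Ω_j» edition — its class-free lemmas `exists_masked_datum`,
`grad_bound_trivial`, `bd2_covDivB_of_grad`, `h33_of_inAk`, `hP_of_datum`, `h69_of_datum`, `hA_of_datum` are USED downstream verbatim),
`B8Prop5SocketDatumSrc` (dag-n05-d; the sourced edition, «box ⊂ Ω_j»), `B8Eq142KLevelLocalGamma` ∕ `B8Thm4KLevelGamma` (dag-n05-e; USED),
`B8Prop3KLevelGamma` (USED), `B8SockP5uEAssemblyB` (dag-n05-d; the consumer whose edition γ follows this file).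
-/

noncomputable section

open NormedSpace
open scoped BigOperators

namespace Literature.MathematicalPhysics.QuantumFieldTheory.Balaban1983to89.B8Prop5SocketDatumGamma

open Complex (I)
open B7Prop1Explicit B7Prop2Explicit B7Prop1Local B7Eq92Concrete
open B7Prop2Explicit (C0 c2')
open B7Prop3Flat (c3)
open B7Eq78Linearization (conjR)
open B8Ineq132 (covDerivFwd covDeriv InAk BondTouches norm_conjR)
open B8Eq119TwistedAxial (Restr129 InAx)
open B8Eq184Proof (cfgExp)
open B8Lemma1NonAbelian (mulCfg)
open B8Eq140Level (SideTouches sideTouches_of_bondTouches)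
open B8Eq146AExpansion (iEta expCfg)
open B7Prop4GeneralLevels (logCovIter linCovIter)
open B8Eq155JBound (Jcur wsup expCfg_iEta_mem_unitaryUnits)
open B8ScaledSupNorm (bondNorm msup weight Bdd)
open B8Ineq130 (tlo thi)
open B8Thm2LogB (blockTop)
open B8Eq138LandauZd (IsLandau138W)
open B8Prop3GaugeFixedKLevel (mem_unitaryUnits_of_mgauge_eq mulCfg_eq_gaugeAct_of_mgauge_eq inAk_congr_of_sideTouches
  expCfg_iEta_eq_cfgExp)
open B8LeafModelZd3 (SockB9P3)
open B8Prop5SocketDatum (grad_bound_trivial)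

-- `Site` alone could resolve to the torus sites of `Setup.lean`; re-export the `ℤ^d` sites of `B7Prop1Explicit`.
export B7Prop1Explicit (Site)

variable {d : ℕ}

/-! ## (1.69)'s gradient member from (1.67)–(1.68) by Proposition 3 at level `m ≥ 1`, edition γ -/

section Grad

variable {𝔸 : Type*} [CStarAlgebra 𝔸] [Nontrivial 𝔸]

/-- ★ **(1.69) FROM (1.67)–(1.68) BY PROPOSITION 3 AT LEVEL `m ≥ 1`, EDITION γ — PRINT's BOX LAW «box ⊂ Ω_{j−1}»** (p. 88 «Proposition 3 implies
that it is enough to prove (1.37), (1.38) and (1.67)»; Prop. 5, p. 94: «for an arbitrary configuration U₁ satisfying (1.69)»).  dag-n05-a's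
`B8Prop5SocketDatum.grad_bound_of_datum` VERBATIM except: the constraint-bond classes `Λb m′` obey print's law «the locality box of a level-`j` bond
lies in `Ω_{j−1}`» (`hbox`; (1.31) p. 82, so the crossing bonds of a level are admissible data; ℕ subtraction, level 0 reads `Ω₀`), the (1.35) datum
hypothesis `h135` is guarded the same way (print p. 77: the bonds «with at least one end-point in Ω_j»), the [3]-Prop.-4 windows of the (1.42) and
(1.56) steps are asked at `(L²α₀, L·α₂)` (`hα3 hα4 h16L hsmall hc₃` — the plaquette and exponent reads on the box happen one level lower), and the
(1.56) remainder constant is any `C₂ ≥ 8·131072(d+1)²·e^{4c·L²α₀}·L²` (`hC₂`).  SETTING otherwise as in the parent: `U₀, U′` unitary with (1.33) `InAk … U₀`,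
(1.34) `InAk … (U′U₀)` + `InAx L m′ (Λs m′) U₀ (U′U₀)`; the DATUM at level `m` (`1 ≤ m ≤ K`): `u₁` unitary, `U₁^{u₁} = U′`, (1.29), the Landau
condition of record, a globally Hermitian exponent `A′` with `U₁ = e^{iηA′}`, `|A′| ≤ α₂(Lʲη)⁻¹` on the sides of the plaquettes touching `Ω_j` (`j ≤ m`),
`A′ = 0` elsewhere; the Prop.-3-frame b9 socket AT LEVEL `m` over the class `Λb` ([4] Thm 3.3) below whose threshold `α₀, α₂` lie; (1.61) and
`dLα₁ ≤ 1/8`.  CONCLUSION — the gradient member of (1.69)∕(1.36)₂ with `B₁ = 5dLB₀`: `(Lʲη)²|(∇^η_{U₀,κ}A′_τ)(y)| ≤ 5dLB₀(α₀ + α₁)` for every side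
`⟨y, y + e_τ⟩` of a plaquette touching `Ω_j`, `j ≤ m`, every `κ`.  PROOF (by name): the parent's — (1.40)₁ for `e^{iηA′}U₀` by gauge invariance and
locality; the (1.42)∕(1.37) clause on `Λb m` by dag-n05-e's `B8Eq142KLevelLocalGamma.H42_of_inAx_γ`; the five (1.59) lines from the socket;
`B8Prop3KLevelGamma.prop3_norms_kLevel_γ` at `m` levels on the bounded gradient family.
[cite: Balaban1985RegularSpaces, (1.67)–(1.69) p.88, Prop. 3 p.87, (1.40)–(1.42) p.83, (1.31) + (1.35) p.82, (1.59)–(1.62) pp.86–87, Prop. 5 p.94; Balaban1985Averaging, Prop. 4 p.38] -/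
theorem grad_bound_of_datum_γ (hd2 : 2 ≤ d) {η : ℝ} (hη : 0 < η) {L : ℕ} (hL : 2 ≤ L) (K : ℕ)
    {U₀ U' : Site d → Fin d → 𝔸ˣ} (hU₀ : ∀ x κ, U₀ x κ ∈ unitaryUnits 𝔸) (hU' : ∀ x κ, U' x κ ∈ unitaryUnits 𝔸)
    {α₀ α₁ α₂ B₀ B₀β C₂ cB9 β : ℝ} {len : Site d → ℝ} (hα₀ : 0 < α₀) (hα₁ : 0 < α₁) (hα₂ : 0 < α₂) (hB₀ : 0 ≤ B₀)
    -- [3] Prop. 4's windows of the (1.42)∕(1.56) steps ONE LEVEL LOWER: at `(L²α₀, Lα₂)`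
    (hα3 : C0 d * ((L : ℝ) ^ 2 * α₀) ≤ 1 / 3) (hα4 : 4 * ((L : ℝ) ^ 2 * α₀) ≤ c2' d L) (h16L : 16 * ((L : ℝ) * α₂) ≤ 1)
    (hsmall : Real.exp (4 * (800 * ((d : ℝ) + 1) ^ 2 * ((d : ℝ) + 4)) * ((L : ℝ) ^ 2 * α₀))
      * (1 + 8 * (131072 * ((d : ℝ) + 1) ^ 2) * ((L : ℝ) * α₂)) ≤ 2)
    (hc₃ : 2 * ((L : ℝ) * α₂) ≤ c3 d L)
    -- the (1.55) window, the bootstrap windows, the (1.56) constant, (1.61), and `dLα₁ ≤ 1/8`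
    (hd5 : 5 * α₂ * ((d : ℝ) - 1) ≤ 4) (hside : 36 * d * B₀ * α₂ ≤ 1 / 2) (h50 : 50 * d * α₂ ≤ 1)
    (hC₂ : 8 * (131072 * ((d : ℝ) + 1) ^ 2) * Real.exp (4 * (800 * ((d : ℝ) + 1) ^ 2 * ((d : ℝ) + 4)) * ((L : ℝ) ^ 2 * α₀))
      * (L : ℝ) ^ 2 ≤ C₂)
    (h61 : 2 * α₂ ^ 2 + 20 * d * α₀ * α₂ + 2 * C₂ * α₂ ^ 2 ≤ α₀ + α₁) (hsmall₁ : (d : ℝ) * L * α₁ ≤ 1 / 8)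
    -- the member's geometry
    (Ω : ℕ → Set (Site d)) (hΩ : ∀ j, Ω (j + 1) ⊆ Ω j) (Λs : ℕ → ℕ → Set (Site d)) (Λb : ℕ → ℕ → Set (Site d × Fin d))
    -- PRINT's box law: the locality box of a datum bond of level `j` lies in `Ω_{j−1}` ((1.31); level 0: `Ω₀`)
    (hbox : ∀ m, m ≤ K → ∀ j, j ≤ m → ∀ c ∈ Λb m j, ∀ x, InBox (loK L j c.1) (bondHiK L j c.1 c.2) x → x ∈ Ω (j - 1))
    (hclass : ∀ m, m ≤ K → ∀ j, j ≤ m → ∀ c ∈ Λb m j,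
      (c.1 ∈ Λs m j ∧ c.1 + e c.2 ∈ Λs m j) ∨
      (∃ j', j = j' + 1 ∧ (∀ x, (L : ℤ) • c.1 ≤ x → x ≤ (L : ℤ) • c.1 + blockTop L → x ∈ Λs m j') ∧ c.1 + e c.2 ∈ Λs m j) ∨
      (∃ j', j = j' + 1 ∧ c.1 ∈ Λs m j ∧ (∀ x, (L : ℤ) • (c.1 + e c.2) ≤ x → x ≤ (L : ℤ) • (c.1 + e c.2) + blockTop L → x ∈ Λs m j')))
    -- the socket's antecedents: (1.33), (1.34), and (1.35)∕(1.66) on every level-`j` bond whose box lies in `Ω_{j−1}` (print p. 77 convention)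
    (h33 : InAk L K η α₀ Ω U₀) (h34 : InAk L K η α₀ Ω (mulCfg U' U₀)) (hAx : ∀ m, m ≤ K → InAx L m (Λs m) U₀ (mulCfg U' U₀))
    (h135 : ∀ j, j ≤ K → ∀ (z : Site d) (μ : Fin d), (∀ x, InBox (loK L j z) (bondHiK L j z μ) x → x ∈ Ω (j - 1)) →
      ‖(avgIter L (mulCfg U' U₀) j z μ : 𝔸) - (avgIter L U₀ j z μ : 𝔸)‖ ≤ α₁)
    -- the b9 socket in Proposition 3's frame AT LEVEL `m`, over the class `Λb`
    {m : ℕ} (hm1 : 1 ≤ m) (hmK : m ≤ K)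
    (SB9 : SockB9P3 (𝔸 := 𝔸) L B₀ B₀β cB9 β len η m Ω Λs Λb) (hα₀9 : α₀ ≤ cB9) (hα₂9 : α₂ ≤ cB9)
    -- the datum at level `m`, with its masked exponent
    {u₁ : Site d → 𝔸ˣ} {U₁ : Site d → Fin d → 𝔸ˣ} {A' : Site d → Fin d → 𝔸}
    (hu₁ : ∀ x, u₁ x ∈ unitaryUnits 𝔸) (hW : mgauge U₀ u₁ U₁ = U') (h129 : Restr129 L m (Λs m) U₀ u₁)
    (hLan : IsLandau138W L m η (Ω 0) (Λs m) U₀ U₁) (hsa : ∀ y τ, IsSelfAdjoint (A' y τ))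
    (hWA : ∀ j, j ≤ m → ∀ (y : Site d) (τ : Fin d), SideTouches (Ω j) y τ →
      U₁ y τ = cfgExp η A' y τ ∧ ‖A' y τ‖ ≤ α₂ * ((L : ℝ) ^ j * η)⁻¹)
    (hA0 : ∀ (y : Site d) (τ : Fin d), (∀ j, j ≤ m → ¬ SideTouches (Ω j) y τ) → A' y τ = 0) :
    ∀ j, j ≤ m → ∀ (y : Site d) (κ τ : Fin d), SideTouches (Ω j) y τ →
      ((L : ℝ) ^ j * η) ^ 2 * ‖covDerivFwd η U₀ κ (fun z => A' z τ) y‖ ≤ 5 * d * L * B₀ * (α₀ + α₁) := by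
  have hL1 : 1 ≤ L := le_trans (by norm_num) hL
  have hLr : (1 : ℝ) ≤ L := by exact_mod_cast hL1
  have hU₀1 : ∀ x κ, U₀ x κ ∈ U1 𝔸 := fun x κ => unitaryUnits_le_U1 (hU₀ x κ)
  -- the (1.55) window `16α₂ ≤ 1` from the γ window `16·Lα₂ ≤ 1` (`L ≥ 1`)
  have h16 : 16 * α₂ ≤ 1 := by
    have h := mul_le_mul_of_nonneg_left hLr (show (0 : ℝ) ≤ 16 * α₂ by positivity)
    linarith [h]
  -- the datum is unitary-valued; its class (1.40)₁ by gauge invariance and locality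
  have hWu : ∀ x κ, U₁ x κ ∈ unitaryUnits 𝔸 := mem_unitaryUnits_of_mgauge_eq hU₀ hU' hu₁ hW
  have h33m : InAk L m η α₀ Ω U₀ := fun j hj => h33 j (hj.trans hmK)
  have h34W : InAk L m η α₀ Ω (mulCfg U₁ U₀) := by
    have h1 : InAk L m η α₀ Ω (mulCfg U' U₀) := fun j hj => h34 j (hj.trans hmK)
    have hui : ∀ x, u₁⁻¹ x ∈ U1 𝔸 := fun x => unitaryUnits_le_U1 ((unitaryUnits 𝔸).inv_mem (hu₁ x))
    rw [mulCfg_eq_gaugeAct_of_mgauge_eq hW]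
    exact (B8Ineq132.inAk_gaugeAct_iff L m η α₀ Ω hui _).2 h1
  have h40₁ : InAk L m η α₀ Ω (mulCfg (expCfg (iEta η A')) U₀) := by
    refine (inAk_congr_of_sideTouches L m η α₀ (V := mulCfg U₁ U₀) fun j hj y τ hs => ?_).1 h34W
    show U₁ y τ * U₀ y τ = expCfg (iEta η A') y τ * U₀ y τ
    rw [(hWA j hj y τ hs).1, expCfg_iEta_eq_cfgExp]
  have h41' : ∀ j, j ≤ m → ∀ (y : Site d) (τ : Fin d), SideTouches (Ω j) y τ → ‖A' y τ‖ ≤ α₂ * ((L : ℝ) ^ j * η)⁻¹ :=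
    fun j hj y τ hs => (hWA j hj y τ hs).2
  -- the gradient datum (bounded family) and its supremum `g`
  have hgrad : ∀ (y : Site d) (κ τ : Fin d), ‖covDerivFwd η U₀ κ (fun z => A' z τ) y‖ ≤ 2 * α₂ * η⁻¹ * η⁻¹ := by
    intro y κ τ
    have h := grad_bound_trivial hη hL1 hU₀ hα₂.le h41' hA0 y κ τ
    have hη2 : 0 < η ^ 2 := by positivity
    rw [show 2 * α₂ * η⁻¹ * η⁻¹ = 2 * α₂ / η ^ 2 by field_simp, le_div_iff₀ hη2, mul_comm]
    exact h
  have hBg : Bdd L m η (-(2 : ℝ)) (fun j (t : Fin d × Fin d × Site d) => SideTouches (Ω j) t.2.2 t.2.1)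
      (fun t => covDerivFwd η U₀ t.1 (fun z => A' z t.2.1) t.2.2) := by
    have e2 : (-(2 : ℝ)) = -((2 : ℕ) : ℝ) := by norm_num
    rw [e2]
    refine B8ScaledSupNorm.bdd_of_forall (c := 2 * α₂ * ((L : ℝ) ^ m) ^ 2) fun j hj t _ => ?_
    rw [B8ScaledSupNorm.weight_neg_natCast L η 2 j]
    have hLjm : (L : ℝ) ^ j ≤ (L : ℝ) ^ m := pow_le_pow_right₀ hLr hj
    have hLj0 : (0 : ℝ) ≤ (L : ℝ) ^ j := by positivity
    calc ((L : ℝ) ^ j * η) ^ 2 * ‖covDerivFwd η U₀ t.1 (fun z => A' z t.2.1) t.2.2‖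
        ≤ ((L : ℝ) ^ j * η) ^ 2 * (2 * α₂ * η⁻¹ * η⁻¹) := mul_le_mul_of_nonneg_left (hgrad _ _ _) (by positivity)
      _ = 2 * α₂ * ((L : ℝ) ^ j) ^ 2 := by field_simp
      _ ≤ 2 * α₂ * ((L : ℝ) ^ m) ^ 2 := by gcongr
  set g : ℝ := msup L m η (-(2 : ℝ)) (fun j (t : Fin d × Fin d × Site d) => SideTouches (Ω j) t.2.2 t.2.1)
      (fun t => covDerivFwd η U₀ t.1 (fun z => A' z t.2.1) t.2.2) with hg_def
  have hg0 : 0 ≤ g := B8ScaledSupNorm.msup_nonneg L m hη.le _ _ _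
  have hg : ∀ j, j ≤ m → ∀ (y : Site d) (κ τ : Fin d), SideTouches (Ω j) y τ →
      ((L : ℝ) ^ j * η) ^ 2 * ‖covDerivFwd η U₀ κ (fun z => A' z τ) y‖ ≤ g := by
    intro j hj y κ τ hs
    have h := B8ScaledSupNorm.weight_mul_norm_le_msup hBg hj (i := (κ, τ, y)) hs
    have hw : weight L η (-(2 : ℝ)) j = ((L : ℝ) ^ j * η) ^ 2 := by
      have e2 : (-(2 : ℝ)) = -((2 : ℕ) : ℝ) := by norm_num
      rw [e2, B8ScaledSupNorm.weight_neg_natCast L η 2 j]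
    rw [hw] at h
    exact h
  -- the five (1.59) lines from the b9 socket at level `m`
  obtain ⟨h59a, h59g, h59j, h59l, -⟩ := SB9 α₀ α₂ hα₀ hα₀9 hα₂ hα₂9 U₀ U₁ hU₀ hWu h33m h34W hLan A' hsa hWA hA0
  -- (1.42)/(1.37) on the constraint bonds of the `m`-truncation, by the (1.42) lemma in edition γ (dag-n05-e)
  have h42 : ∀ j, j ≤ m → ∀ c ∈ Λb m j, ‖logCovIter L U₀ (iEta η A') j c.1 c.2‖ < 2 * d * L * α₁ :=
    B8Eq142KLevelLocalGamma.H42_of_inAx_γ hd2 hη hL K hU₀ hα₀ hα₁ hα₂.le hα3 hα4 h16L hsmall hc₃ hsmall₁ Ω hΩ Λs Λb hbox hclass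
      h33 h34 hAx h135 (fun m W => IsLandau138W L m η (Ω 0) (Λs m) U₀ W) m hm1 hmK u₁ U₁ A' hu₁ hW h129 hLan hsa hWA hA0
  have hboxm : ∀ j, j ≤ m → ∀ c ∈ Λb m j, ∀ x, InBox (loK L j c.1) (bondHiK L j c.1 c.2) x → x ∈ Ω (j - 1) :=
    fun j hj c hc x hx => hbox m hmK j hj c hc x hx
  -- PROPOSITION 3 at `m` levels, edition γ: the gradient member
  obtain ⟨-, hg', -, -⟩ := B8Prop3KLevelGamma.prop3_norms_kLevel_γ hd2 hη hL hU₀ hsa hα₀ hα₁.le hα₂.le hg0 hα3 hα4 h16 hd5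
    hsmall hc₃ hB₀ hside h50 hC₂ h61 hboxm h33m h40₁ h41' hg h42 h59a h59g h59j h59l
  intro j hj y κ τ hs
  exact (hg j hj y κ τ hs).trans hg'

#print axioms grad_bound_of_datum_γ

end Grad

end Literature.MathematicalPhysics.QuantumFieldTheory.Balaban1983to89.B8Prop5SocketDatumGamma

end
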